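import Summits.BirchSwinnertonDyer.BirchSwinnertonDyer.Theorems.QuadraticBranchSignedControlPlusKatoDivisibilityBranchOntoOfFacts
import HarnessLib

/-!
# Route `QuadraticBranchSignedControl` (rung K8, cell `bsd-potss`): glue item 21365
# `PlusKatoDivisibilityBranchOntoOfNamedFacts` — the three held aliases imply the crux 20445
# `PlusKatoDivisibilityBranchOnto`

WHAT. Route rev 24 (planner g23, 2026-08-27) split the crux `PlusKatoDivisibilityBranchOnto` (item
stmt-BirchSwinnertonDyer-20445: Kato's divisibility in Kobayashi's plus theory at the quadratic
character `η`, on the tower-onto rows) into three held by-name aliases of named Literature facts —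
`PublishedInputKobZetaEtaOnto` := `Kobayashi2003.thm62_63_73_etaColemanPoitouTate_zeta` (Kobayashi
2003 Thm. 6.2/6.3/7.3 i)/Cor. 7.2 at `η` with `z` a genuine Euler-system class),
`PublishedInputKatoThm134Onto` := `Kato2004.thm13_4_lengthAt_fineSelmerDual_le_of_isEulerSystemClass`
(Kato 2004 Thm. 13.4, reduction-free Euler-system bound), `PublishedInputKobThm12Onto` :=
`Kobayashi2003.thm12_signedSelmerDual_finite_torsion` (Kobayashi Thm. 1.2) — plus the glue decl
`PlusKatoDivisibilityBranchOntoOfNamedFacts := alias₁ → alias₂ → alias₃ → PlusKatoDivisibilityBranchOnto`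
(item stmt-BirchSwinnertonDyer-21365). The gate refused `--glue-by` (the kernel term lives in a
module importing the Theses file: `glue.cyclic-import`), so the glue is landed HERE as a theorem whose
type is the route decl literally. PROOF: the three aliases unfold by `rfl` to the named facts, and
`KatoSideOnto.plusKatoDivisibilityBranchOnto_of_zeta_of_thm13_4_of_thm12` (seat k8q-c2x g4, p553368;
import closure free of the modules reddened by rev 23) concludes the crux decl by name.

HONEST FRAMING (cell `bsd-potss`, run/shared/lean/pub/bsd-potss/; FULL-BSD rank ≤ 1 programme): this
is a GLUE theorem — an implication between route decls; it proves the crux only OVER its three named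
published inputs (held, cite-level; none of them has a `_holds` in the tree). Nothing is booked; BSD is
claimed for no pair; closing the glue item records that the split is sound, not that the crux is
unconditional. Seat `bsd-potss-k8q-c2x` (prover), g5; `--workitem stmt-BirchSwinnertonDyer-21365`.

References: [Kobayashi2003] Thm. 1.2 (p. 2), Thm. 6.2–6.3, Cor. 7.2, Thm. 7.3 i) (pp. 10–13);
[Kato2004Asterisque] Thm. 13.4 (p. 226).
-/

noncomputable section

-- justification: the `Summit.BirchSwinnertonDyer.BirchSwinnertonDyer.…` path repeats a component (route-file convention)
set_option linter.dupNamespace false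

open Summit.BirchSwinnertonDyer.BirchSwinnertonDyer.Theses.QuadraticBranchSignedControl

namespace Summit.BirchSwinnertonDyer.BirchSwinnertonDyer.Theorems

/-- **Glue item 21365 `PlusKatoDivisibilityBranchOntoOfNamedFacts`** (route decl literally):
`PublishedInputKobZetaEtaOnto → PublishedInputKatoThm134Onto → PublishedInputKobThm12Onto →
PlusKatoDivisibilityBranchOnto`. The three hypotheses are the route's held by-name aliases of
`Kobayashi2003.thm62_63_73_etaColemanPoitouTate_zeta`, `Kato2004.thm13_4_lengthAt_fineSelmerDual_le_of_isEulerSystemClass`,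
`Kobayashi2003.thm12_signedSelmerDual_finite_torsion` (definitional unfolding); the conclusion is
`KatoSideOnto.plusKatoDivisibilityBranchOnto_of_zeta_of_thm13_4_of_thm12` (p553368). GLUE ONLY — the
crux stays conditional on the three held inputs.
[cite: Kobayashi2003, Thm. 1.2 (p. 2), Thm. 6.2–6.3, Cor. 7.2, Thm. 7.3 i) (pp. 10–13)]
[cite: Kato2004Asterisque, Thm. 13.4 (p. 226)] -/
theorem plusKatoDivisibilityBranchOntoOfNamedFacts_proof :
    Summit.BirchSwinnertonDyer.BirchSwinnertonDyer.Theses.QuadraticBranchSignedControl.PlusKatoDivisibilityBranchOntoOfNamedFacts := by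
  unfold PlusKatoDivisibilityBranchOntoOfNamedFacts
  intro hZ h134 h12
  exact KatoSideOnto.plusKatoDivisibilityBranchOnto_of_zeta_of_thm13_4_of_thm12 hZ h134 h12

end Summit.BirchSwinnertonDyer.BirchSwinnertonDyer.Theorems

end
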